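import Summits.QuantumFields.BalabanUV.Beta.EriceFlowEnclosureCesaroTauberianSeqRate
import Summits.QuantumFields.BalabanUV.Beta.EriceFlowEnclosureWeightedTauberianPower

/-!
# Beta / EriceFlowEnclosureWeightedTauberianSeqRate — THE SQUARE-ROOT LAW FOR WEIGHTED CUTOFF AVERAGES: UNDOING A (G)-WEIGHTED AVERAGE COSTS THE SAME
# SQUARE ROOT AS (C,1), WITH A CONSTANT `(Λ + 1)∕κ` FROM THE LOCAL GROWTH κ AND THE TRIPLING BOUND Λ OF THE MASS — for the power weights `(n+1)^σ`
# the constant degenerates like `(σ + 1)⁻²` at the logarithmic end σ ↓ −1, where the qualitative theorem itself fails (P2 #54e∕#54f)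
# (pure [folklore] SERVICE; the weighted twin of P2 #53d `sqrt_law`; imports P2 #53d (the window index) and P2 #54c∕#54d).
#   §1 `wone_scale` — the two-sided weighted one-scale estimate from the UPPER window alone: N < J, `0 < P N < P J`, `|a i − a N| ≤ w` on [N, J[, means
#      within E₂, E₁ of m at J, N ⟹ **`|a N − m| ≤ w + (P J·E₂ + P N·E₁)∕(P J − P N)`**;
#   §2 HEADLINE **`wsqrt_law`** — p ≥ 0, at a scale N ≥ 1 with `P N > 0`, LOCAL GROWTH `κ·((J − N)∕N)·P N ≤ P J − P N` for N ≤ J ≤ 3N and TRIPLING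
#      `P(3N) ≤ Λ·P N`, a asymptotically K-log-Lipschitz with slack τ on [N, 2N], weighted means within E (0 < E ≤ 1) of m on [N, 3N] ⟹
#      **`|a N − m| ≤ K·(√E + 1∕N) + τ + (Λ + 1)·√E∕κ`** (window J = N + ⌈√E·N⌉ of P2 #53d `window_index`);
#   §3 INSTANCES — p ≡ 1: κ = 1, Λ = 3 (`wsqrt_law_one`: `|a N − m| ≤ K(√E + 1∕N) + τ + 4√E`, P2 #53d's law up to constants); POWER WEIGHTS
#      `(n+1)^σ`, −1 < σ ≤ 0: `powerMass_lower` (`N^{σ+1} ≤ P N`), `powerMass_upper` (`P N ≤ ((σ+3)∕(σ+1))·N^{σ+1}`), `powerMass_localGrowth`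
#      (κ = (σ+1)∕(3(σ+3))), `powerMass_tripling` (Λ = 3(σ+3)∕(σ+1)), END **`power_wsqrt_law`**: `|a N − m| ≤ K(√E + 1∕N) + τ + C_σ·√E` with
#      `C_σ = (3(σ+3)∕(σ+1) + 1)·3(σ+3)∕(σ+1)` — ONE HALVING for every power weight, constant ∝ (σ+1)⁻².
# (β-flow team, prover 2 = lower ∕ positivity side, unit `b2b-balaban-beta-bflow-p2`, gen 37; module P2 #54l; no Erice sentence occurs)

HONEST FRAMING (page 1 of everything the β sub-cell writes): discharging `BetaPertH` makes Bałaban's UV stability UNCONDITIONAL — a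
real constructive-QFT result; it is NOT the continuum limit and NOT the Clay problem.  HONEST DEPENDENCY (cell reorg 2026-08-19,
verbatim): «continuum YM on T⁴ ⇐ BetaPertH ∧ nine spine estimates (0/9 proved); BetaPertH ⇐ (D1) ∧ (D4) ∧ CAP+tail; G-an2-4 gates
asym, D1 and NE2/3/4.»  THIS MODULE DISCHARGES NOTHING and quotes nothing: [folklore] real analysis (the quantitative one-scale argument of R. Schmidt
with weights; cf. Hardy, Divergent Series §6.3; Ganelius, LNM 232 Ch. 1 for O-Tauberian remainders).

WHAT THIS FILE PROVES (0 sorry, 0 def): §1 `wone_scale`; §2 HEADLINE **`wsqrt_law`**; §3 `wsqrt_law_one`, `powerMass_lower`, `powerMass_upper`,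
`powerMass_localGrowth`, `powerMass_tripling`, END **`power_wsqrt_law`**.
NOT CLAIMED: optimality of the constants; the Abel method (its Tauberian remainder is LOGARITHMIC, not a square root — Korevaar, Tauberian Theory ch. VII;
not formalised); `BetaPertH`; continuum; Clay.
-/

namespace Summit.QuantumFields.BalabanUV.Beta.EriceFlowEnclosureWeightedTauberianSeqRate

open Finset Filter Topology
open Summit.QuantumFields.BalabanUV.Beta.EriceFlowEnclosureCesaroTauberianSeqRate (window_index)
open Summit.QuantumFields.BalabanUV.Beta.EriceFlowEnclosureWeightedTauberianSeq (wsum_window_upper quot_abs_le wupper_of_window)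

noncomputable section

variable {a p : ℕ → ℝ}

/-! ## §1 The two-sided weighted one-scale estimate -/

/-- **ONE SCALE (weighted, two-sided, upper window only).**  p ≥ 0, N < J, `0 < P N < P J`, `|a i − a N| ≤ w` for `N ≤ i < J`, the weighted means at
J and N within E₂, E₁ of m ⟹ **`|a N − m| ≤ w + (P J·E₂ + P N·E₁)∕(P J − P N)`**. [folklore] -/
theorem wone_scale (hp : ∀ n, 0 ≤ p n) {N J : ℕ} (hNJ : N < J)
    (hPN : 0 < ∑ n ∈ range N, p n) (hPJ : ∑ n ∈ range N, p n < ∑ n ∈ range J, p n) {w m E₁ E₂ : ℝ}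
    (hw : ∀ i, N ≤ i → i < J → |a i - a N| ≤ w)
    (hJ : |(∑ n ∈ range J, p n * a n) / (∑ n ∈ range J, p n) - m| ≤ E₂)
    (hN : |(∑ n ∈ range N, p n * a n) / (∑ n ∈ range N, p n) - m| ≤ E₁) :
    |a N - m| ≤ w + ((∑ n ∈ range J, p n) * E₂ + (∑ n ∈ range N, p n) * E₁) /
      (∑ n ∈ range J, p n - ∑ n ∈ range N, p n) := by
  have hd : 0 < ∑ n ∈ range J, p n - ∑ n ∈ range N, p n := sub_pos.mpr hPJ
  have hwlo : ∀ i, N ≤ i → i < J → a N - w ≤ a i := fun i h1 h2 => by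
    have := (abs_le.mp (hw i h1 h2)).1; linarith
  have hwhi : ∀ i, N ≤ i → i < J → a i ≤ a N + w := fun i h1 h2 => by
    have := (abs_le.mp (hw i h1 h2)).2; linarith
  have hup := wupper_of_window hp hNJ.le hPN hPJ hwlo hJ hN
  have h1 : ∑ n ∈ range J, p n * a n - ∑ n ∈ range N, p n * a n ≤
      (∑ n ∈ range J, p n - ∑ n ∈ range N, p n) * (a N + w) := wsum_window_upper hp hNJ.le hwhi
  have h2 := (abs_le.mp (quot_abs_le hPN hPJ hJ hN)).1
  have h3 : (∑ n ∈ range J, p n * a n - ∑ n ∈ range N, p n * a n) /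
      (∑ n ∈ range J, p n - ∑ n ∈ range N, p n) ≤ a N + w := by
    rw [div_le_iff₀ hd]; linarith
  rw [abs_le]; constructor <;> linarith

/-! ## §2 The square-root law under local growth and tripling of the mass -/

/-- **THE SQUARE-ROOT LAW FOR WEIGHTED CUTOFF AVERAGES (HEADLINE).**  p ≥ 0; at a scale N ≥ 1 with `0 < P N`: LOCAL GROWTH `κ·((J − N)∕N)·P N ≤ P J − P N`
for all `N ≤ J ≤ 3N` (κ > 0) and TRIPLING `P(3N) ≤ Λ·P N`; a with `|a i − a N| ≤ K·log(i∕N) + τ` for `N ≤ i ≤ 2N` (K ≥ 0); weighted means within E of m for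
`N ≤ n ≤ 3N` (0 < E ≤ 1).  Then **`|a N − m| ≤ K·(√E + 1∕N) + τ + (Λ + 1)·√E∕κ`** — the window [N, N + ⌈√E·N⌉[ (P2 #53d `window_index`) has mass
`≥ κ√E·P N` and total `≤ Λ·P N`. [folklore] -/
theorem wsqrt_law (hp : ∀ n, 0 ≤ p n) {K τ m E κ Λ : ℝ} (hK : 0 ≤ K) (hκ : 0 < κ) {N : ℕ} (hN1 : 1 ≤ N)
    (hE0 : 0 < E) (hE1 : E ≤ 1) (hPN : 0 < ∑ n ∈ range N, p n)
    (hgrow : ∀ J : ℕ, N ≤ J → J ≤ 3 * N →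
      κ * (((J : ℝ) - N) / N) * (∑ n ∈ range N, p n) ≤ ∑ n ∈ range J, p n - ∑ n ∈ range N, p n)
    (htrip : ∑ n ∈ range (3 * N), p n ≤ Λ * ∑ n ∈ range N, p n)
    (hlip : ∀ i : ℕ, N ≤ i → i ≤ 2 * N → |a i - a N| ≤ K * Real.log ((i : ℝ) / N) + τ)
    (hmean : ∀ n : ℕ, N ≤ n → n ≤ 3 * N → |(∑ k ∈ range n, p k * a k) / (∑ k ∈ range n, p k) - m| ≤ E) :
    |a N - m| ≤ K * (Real.sqrt E + 1 / N) + τ + (Λ + 1) * Real.sqrt E / κ := by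
  set r := Real.sqrt E with hr
  have hr0 : 0 < r := Real.sqrt_pos.mpr hE0
  have hr1 : r ≤ 1 := by rw [hr]; exact Real.sqrt_le_one.mpr hE1
  have hrr : r * r = E := by rw [hr]; exact Real.mul_self_sqrt hE0.le
  have hNpos : 0 < (N : ℝ) := Nat.cast_pos.mpr (lt_of_lt_of_le Nat.one_pos hN1)
  obtain ⟨hNJ, hJ3, hDlo, hDhi, hwin, hlog⟩ := window_index hr0 hr1 hN1
  set J : ℕ := N + ⌈r * (N : ℝ)⌉₊ with hJ
  set PN := ∑ n ∈ range N, p n with hPNdef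
  set PJ := ∑ n ∈ range J, p n with hPJdef
  -- the window bound w = K log(J∕N) + τ ≤ K (r + 1∕N) + τ
  have hw : ∀ i, N ≤ i → i < J → |a i - a N| ≤ K * (r + 1 / N) + τ := by
    intro i h1 h2
    have hi2 : i ≤ 2 * N := hwin i h2
    have h := hlip i h1 hi2
    have hipos : 0 < (i : ℝ) := lt_of_lt_of_le hNpos (Nat.cast_le.mpr h1)
    have hlogi : Real.log ((i : ℝ) / N) ≤ Real.log ((J : ℝ) / N) :=
      Real.log_le_log (div_pos hipos hNpos) (div_le_div_of_nonneg_right (Nat.cast_le.mpr h2.le) hNpos.le)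
    have := mul_le_mul_of_nonneg_left (hlogi.trans hlog) hK
    linarith
  -- masses: P J − P N ≥ κ r P N > 0, P J ≤ Λ P N
  have hgrowJ := hgrow J hNJ.le hJ3
  have hκr : κ * r * PN ≤ PJ - PN := by
    have h1 : κ * r * PN ≤ κ * (((J : ℝ) - N) / N) * PN := by
      have : r ≤ ((J : ℝ) - N) / N := by rw [le_div_iff₀ hNpos]; exact hDlo
      exact mul_le_mul_of_nonneg_right (mul_le_mul_of_nonneg_left this hκ.le) hPN.le
    exact h1.trans hgrowJ
  have hd0 : 0 < PJ - PN := lt_of_lt_of_le (by positivity) hκr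
  have hPJ : PN < PJ := by linarith
  have hPJ3 : PJ ≤ ∑ n ∈ range (3 * N), p n :=
    sum_le_sum_of_subset_of_nonneg (range_subset_range.mpr hJ3) fun n _ _ => hp n
  have hPJΛ : PJ ≤ Λ * PN := hPJ3.trans htrip
  -- the means at J and N
  have hEJ := hmean J hNJ.le hJ3
  have hEN := hmean N le_rfl (by omega)
  have h := wone_scale hp hNJ hPN hPJ hw hEJ hEN
  -- the quotient (PJ E + PN E)∕(PJ − PN) ≤ (Λ+1) E∕(κ r) = (Λ+1) r∕κ
  have hquot : (PJ * E + PN * E) / (PJ - PN) ≤ (Λ + 1) * r / κ := by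
    rw [div_le_div_iff₀ hd0 hκ]
    have h1 : (PJ * E + PN * E) * κ ≤ (Λ + 1) * PN * E * κ := by
      have : PJ * E + PN * E ≤ (Λ + 1) * PN * E := by nlinarith
      exact mul_le_mul_of_nonneg_right this hκ.le
    have h2 : (Λ + 1) * PN * E * κ = (Λ + 1) * r * (κ * r * PN) := by rw [← hrr]; ring
    have hΛ1 : 0 ≤ Λ + 1 := by
      have : PN ≤ Λ * PN := le_trans hPJ.le hPJΛ
      nlinarith
    have h3 : (Λ + 1) * r * (κ * r * PN) ≤ (Λ + 1) * r * (PJ - PN) :=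
      mul_le_mul_of_nonneg_left hκr (mul_nonneg hΛ1 hr0.le)
    linarith
  linarith

/-! ## §3 Instances: p ≡ 1 and the power weights -/

/-- p ≡ 1 (the (C,1) mass P N = N): κ = 1, Λ = 3, so **`|a N − m| ≤ K(√E + 1∕N) + τ + 4√E`** — P2 #53d `sqrt_law` up to the constants. [folklore] -/
theorem wsqrt_law_one {K τ m E : ℝ} (hK : 0 ≤ K) {N : ℕ} (hN1 : 1 ≤ N) (hE0 : 0 < E) (hE1 : E ≤ 1)
    (hlip : ∀ i : ℕ, N ≤ i → i ≤ 2 * N → |a i - a N| ≤ K * Real.log ((i : ℝ) / N) + τ)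
    (hmean : ∀ n : ℕ, N ≤ n → n ≤ 3 * N →
      |(∑ k ∈ range n, (1 : ℝ) * a k) / (∑ _k ∈ range n, (1 : ℝ)) - m| ≤ E) :
    |a N - m| ≤ K * (Real.sqrt E + 1 / N) + τ + (3 + 1) * Real.sqrt E / 1 := by
  have hNpos : 0 < (N : ℝ) := Nat.cast_pos.mpr (lt_of_lt_of_le Nat.one_pos hN1)
  have hP : ∀ n : ℕ, ∑ _k ∈ range n, (1 : ℝ) = n := fun n => by rw [sum_const, card_range, nsmul_eq_mul, mul_one]
  refine wsqrt_law (p := fun _ => (1 : ℝ)) (fun _ => zero_le_one) hK one_pos hN1 hE0 hE1 (by rw [hP]; exact hNpos)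
    (fun J h1 _ => ?_) (by rw [hP, hP]; push_cast; linarith) hlip hmean
  rw [hP, hP, one_mul, div_mul_cancel₀ _ hNpos.ne']

/-- THE POWER MASS FROM BELOW: for σ ≤ 0 and N ≥ 1, `N^{σ+1} ≤ Σ_{n<N} (n+1)^σ` (each term is `≥ N^σ`). [folklore] -/
theorem powerMass_lower {σ : ℝ} (hσ0 : σ ≤ 0) {N : ℕ} (hN1 : 1 ≤ N) :
    (N : ℝ) ^ (σ + 1) ≤ ∑ n ∈ range N, ((n : ℝ) + 1) ^ σ := by
  have hNpos : 0 < (N : ℝ) := Nat.cast_pos.mpr (lt_of_lt_of_le Nat.one_pos hN1)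
  have hterm : ∀ n ∈ range N, (N : ℝ) ^ σ ≤ ((n : ℝ) + 1) ^ σ := by
    intro n hn
    have hn1 : (n : ℝ) + 1 ≤ N := by exact_mod_cast Nat.succ_le_of_lt (mem_range.mp hn)
    exact Real.rpow_le_rpow_of_nonpos (by positivity) hn1 hσ0
  have h := sum_le_sum hterm
  rw [sum_const, card_range, nsmul_eq_mul] at h
  rw [Real.rpow_add hNpos, Real.rpow_one, mul_comm]
  exact h

/-- THE POWER MASS FROM ABOVE: for −1 < σ ≤ 0 and N ≥ 1, `Σ_{n<N} (n+1)^σ ≤ ((σ+3)∕(σ+1))·N^{σ+1}` (the tree's integral comparison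
`rpow_bounds_sum_range_rpow` and `(N+1)^{σ+1} ≤ 2N^{σ+1}`). [folklore] -/
theorem powerMass_upper {σ : ℝ} (hσ1 : -1 < σ) (hσ0 : σ ≤ 0) {N : ℕ} (hN1 : 1 ≤ N) :
    ∑ n ∈ range N, ((n : ℝ) + 1) ^ σ ≤ (σ + 3) / (σ + 1) * (N : ℝ) ^ (σ + 1) := by
  have hs : 0 < σ + 1 := by linarith
  have hNpos : 0 < (N : ℝ) := Nat.cast_pos.mpr (lt_of_lt_of_le Nat.one_pos hN1)
  have hN1' : (1 : ℝ) ≤ N := by exact_mod_cast hN1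
  have hup := (Literature.Analysis.Asymptotics.rpow_bounds_sum_range_rpow hσ1 hσ0 N).2
  -- (N+1)^{σ+1} ≤ (2N)^{σ+1} = 2^{σ+1} N^{σ+1} ≤ 2 N^{σ+1}
  have h1 : ((N : ℝ) + 1) ^ (σ + 1) ≤ 2 * (N : ℝ) ^ (σ + 1) := by
    have h2 : ((N : ℝ) + 1) ^ (σ + 1) ≤ (2 * (N : ℝ)) ^ (σ + 1) :=
      Real.rpow_le_rpow (by positivity) (by linarith) hs.le
    have h3 : (2 * (N : ℝ)) ^ (σ + 1) = (2 : ℝ) ^ (σ + 1) * (N : ℝ) ^ (σ + 1) := Real.mul_rpow (by norm_num) hNpos.le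
    have h4 : (2 : ℝ) ^ (σ + 1) ≤ 2 := by
      have := Real.rpow_le_rpow_of_exponent_le (show (1 : ℝ) ≤ 2 by norm_num) (show σ + 1 ≤ 1 by linarith)
      rwa [Real.rpow_one] at this
    have h5 : 0 ≤ (N : ℝ) ^ (σ + 1) := Real.rpow_nonneg hNpos.le _
    nlinarith
  have hNσ : 1 ≤ (N : ℝ) ^ (σ + 1) := Real.one_le_rpow hN1' hs.le
  -- Σ ≤ 1 + ((N+1)^{σ+1} − 1)/(σ+1) ≤ 1 + 2N^{σ+1}/(σ+1) ≤ (1 + 2/(σ+1)) N^{σ+1}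
  have h6 : 1 + (((N : ℝ) + 1) ^ (σ + 1) - 1) / (σ + 1) ≤ (σ + 3) / (σ + 1) * (N : ℝ) ^ (σ + 1) := by
    rw [show (σ + 3) / (σ + 1) * (N : ℝ) ^ (σ + 1) = (N : ℝ) ^ (σ + 1) + 2 * (N : ℝ) ^ (σ + 1) / (σ + 1) by
      field_simp; ring]
    have h7 : (((N : ℝ) + 1) ^ (σ + 1) - 1) / (σ + 1) ≤ 2 * (N : ℝ) ^ (σ + 1) / (σ + 1) :=
      div_le_div_of_nonneg_right (by linarith) hs.le
    linarith
  exact hup.trans h6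

/-- LOCAL GROWTH OF THE POWER MASS: −1 < σ ≤ 0, 1 ≤ N ≤ J ≤ 3N ⟹ with `κ = (σ+1)∕(3(σ+3))`:
`κ·((J − N)∕N)·P N ≤ P J − P N` (the window terms are `≥ (3N)^σ ≥ 3^{-1}N^σ`, and `P N ≤ ((σ+3)∕(σ+1))N^{σ+1}`). [folklore] -/
theorem powerMass_localGrowth {σ : ℝ} (hσ1 : -1 < σ) (hσ0 : σ ≤ 0) {N J : ℕ} (hN1 : 1 ≤ N) (hNJ : N ≤ J) (hJ3 : J ≤ 3 * N) :
    (σ + 1) / (3 * (σ + 3)) * (((J : ℝ) - N) / N) * (∑ n ∈ range N, ((n : ℝ) + 1) ^ σ) ≤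
      ∑ n ∈ range J, ((n : ℝ) + 1) ^ σ - ∑ n ∈ range N, ((n : ℝ) + 1) ^ σ := by
  have hs : 0 < σ + 1 := by linarith
  have hs3 : 0 < σ + 3 := by linarith
  have hs' : σ + 1 ≠ 0 := hs.ne'
  have hs3' : σ + 3 ≠ 0 := hs3.ne'
  have hNpos : 0 < (N : ℝ) := Nat.cast_pos.mpr (lt_of_lt_of_le Nat.one_pos hN1)
  have hN0 : (N : ℝ) ≠ 0 := hNpos.ne'
  have hJN : (0 : ℝ) ≤ (J : ℝ) - N := by have : (N : ℝ) ≤ J := Nat.cast_le.mpr hNJ; linarith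
  have hcoef : 0 ≤ (σ + 1) / (3 * (σ + 3)) * (((J : ℝ) - N) / N) :=
    mul_nonneg (div_nonneg hs.le (by linarith)) (div_nonneg hJN hNpos.le)
  -- the window sum is ≥ (J − N)·(3N)^σ
  have hwin : ((J : ℝ) - N) * (3 * (N : ℝ)) ^ σ ≤ ∑ n ∈ range J, ((n : ℝ) + 1) ^ σ - ∑ n ∈ range N, ((n : ℝ) + 1) ^ σ := by
    rw [← sum_Ico_eq_sub _ hNJ]
    have hterm : ∀ n ∈ Ico N J, (3 * (N : ℝ)) ^ σ ≤ ((n : ℝ) + 1) ^ σ := by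
      intro n hn
      have hnJ : (n : ℝ) + 1 ≤ 3 * N := by
        have := (mem_Ico.mp hn).2; exact_mod_cast (Nat.succ_le_of_lt this).trans hJ3
      exact Real.rpow_le_rpow_of_nonpos (by positivity) hnJ hσ0
    have h := sum_le_sum hterm
    rw [sum_const, Nat.card_Ico, nsmul_eq_mul, Nat.cast_sub hNJ] at h
    exact h
  -- (3N)^σ ≥ N^σ∕3
  have h3σ : (N : ℝ) ^ σ / 3 ≤ (3 * (N : ℝ)) ^ σ := by
    rw [Real.mul_rpow (by norm_num) hNpos.le]
    have h1 : (1 : ℝ) / 3 ≤ (3 : ℝ) ^ σ := by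
      have h2 : (3 : ℝ) ^ (-1 : ℝ) ≤ (3 : ℝ) ^ σ := Real.rpow_le_rpow_of_exponent_le (by norm_num) hσ1.le
      rw [Real.rpow_neg_one] at h2
      have : (1 : ℝ) / 3 = (3 : ℝ)⁻¹ := by norm_num
      linarith
    have hNσ : 0 ≤ (N : ℝ) ^ σ := Real.rpow_nonneg hNpos.le σ
    calc (N : ℝ) ^ σ / 3 = 1 / 3 * (N : ℝ) ^ σ := by ring
      _ ≤ (3 : ℝ) ^ σ * (N : ℝ) ^ σ := mul_le_mul_of_nonneg_right h1 hNσ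
  -- P N ≤ ((σ+3)/(σ+1)) N^{σ+1} = ((σ+3)/(σ+1)) N · N^σ
  have hup := powerMass_upper hσ1 hσ0 hN1
  have hsplit : (N : ℝ) ^ (σ + 1) = (N : ℝ) ^ σ * N := by rw [Real.rpow_add hNpos, Real.rpow_one]
  have hPN0 : 0 ≤ ∑ n ∈ range N, ((n : ℝ) + 1) ^ σ := sum_nonneg fun n _ => Real.rpow_nonneg (by positivity) σ
  calc (σ + 1) / (3 * (σ + 3)) * (((J : ℝ) - N) / N) * (∑ n ∈ range N, ((n : ℝ) + 1) ^ σ)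
      ≤ (σ + 1) / (3 * (σ + 3)) * (((J : ℝ) - N) / N) * ((σ + 3) / (σ + 1) * (N : ℝ) ^ (σ + 1)) :=
        mul_le_mul_of_nonneg_left hup hcoef
    _ = ((J : ℝ) - N) * ((N : ℝ) ^ σ / 3) := by rw [hsplit]; field_simp
    _ ≤ ((J : ℝ) - N) * (3 * (N : ℝ)) ^ σ := mul_le_mul_of_nonneg_left h3σ hJN
    _ ≤ _ := hwin

/-- TRIPLING OF THE POWER MASS: −1 < σ ≤ 0, N ≥ 1 ⟹ `P(3N) ≤ (3(σ+3)∕(σ+1))·P N`. [folklore] -/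
theorem powerMass_tripling {σ : ℝ} (hσ1 : -1 < σ) (hσ0 : σ ≤ 0) {N : ℕ} (hN1 : 1 ≤ N) :
    ∑ n ∈ range (3 * N), ((n : ℝ) + 1) ^ σ ≤ 3 * (σ + 3) / (σ + 1) * ∑ n ∈ range N, ((n : ℝ) + 1) ^ σ := by
  have hs : 0 < σ + 1 := by linarith
  have hNpos : 0 < (N : ℝ) := Nat.cast_pos.mpr (lt_of_lt_of_le Nat.one_pos hN1)
  have hup := powerMass_upper hσ1 hσ0 (show 1 ≤ 3 * N by omega)
  have hlo := powerMass_lower hσ0 hN1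
  -- (3N)^{σ+1} = 3^{σ+1} N^{σ+1} ≤ 3 N^{σ+1}
  have h1 : ((3 * N : ℕ) : ℝ) ^ (σ + 1) ≤ 3 * (N : ℝ) ^ (σ + 1) := by
    push_cast
    rw [Real.mul_rpow (by norm_num) hNpos.le]
    have h4 : (3 : ℝ) ^ (σ + 1) ≤ 3 := by
      have := Real.rpow_le_rpow_of_exponent_le (show (1 : ℝ) ≤ 3 by norm_num) (show σ + 1 ≤ 1 by linarith)
      rwa [Real.rpow_one] at this
    exact mul_le_mul_of_nonneg_right h4 (Real.rpow_nonneg hNpos.le _)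
  have hc : 0 ≤ (σ + 3) / (σ + 1) := div_nonneg (by linarith) hs.le
  have hc3 : 0 ≤ 3 * (σ + 3) / (σ + 1) := div_nonneg (by linarith) hs.le
  calc ∑ n ∈ range (3 * N), ((n : ℝ) + 1) ^ σ ≤ (σ + 3) / (σ + 1) * ((3 * N : ℕ) : ℝ) ^ (σ + 1) := hup
    _ ≤ (σ + 3) / (σ + 1) * (3 * (N : ℝ) ^ (σ + 1)) := mul_le_mul_of_nonneg_left h1 hc
    _ = 3 * (σ + 3) / (σ + 1) * (N : ℝ) ^ (σ + 1) := by ring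
    _ ≤ 3 * (σ + 3) / (σ + 1) * ∑ n ∈ range N, ((n : ℝ) + 1) ^ σ := mul_le_mul_of_nonneg_left hlo hc3

/-- **THE SQUARE-ROOT LAW FOR EVERY POWER WEIGHT (END).**  −1 < σ ≤ 0; at a scale N ≥ 1, a with `|a i − a N| ≤ K·log(i∕N) + τ` on [N, 2N] and the
`(n+1)^σ`-weighted means within E (0 < E ≤ 1) of m on [N, 3N] ⟹ **`|a N − m| ≤ K·(√E + 1∕N) + τ + C_σ·√E`**, `C_σ = (3(σ+3)∕(σ+1) + 1)·(3(σ+3)∕(σ+1))`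
— ONE HALVING as for (C,1) (P2 #53d), with a constant `∝ (σ+1)⁻²` that blows up exactly at the logarithmic end σ ↓ −1, where no Tauberian theorem survives
(P2 #54f). [folklore] -/
theorem power_wsqrt_law {σ : ℝ} (hσ1 : -1 < σ) (hσ0 : σ ≤ 0) {K τ m E : ℝ} (hK : 0 ≤ K) {N : ℕ} (hN1 : 1 ≤ N)
    (hE0 : 0 < E) (hE1 : E ≤ 1)
    (hlip : ∀ i : ℕ, N ≤ i → i ≤ 2 * N → |a i - a N| ≤ K * Real.log ((i : ℝ) / N) + τ)
    (hmean : ∀ n : ℕ, N ≤ n → n ≤ 3 * N →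
      |(∑ k ∈ range n, ((k : ℝ) + 1) ^ σ * a k) / (∑ k ∈ range n, ((k : ℝ) + 1) ^ σ) - m| ≤ E) :
    |a N - m| ≤ K * (Real.sqrt E + 1 / N) + τ +
      (3 * (σ + 3) / (σ + 1) + 1) * Real.sqrt E / ((σ + 1) / (3 * (σ + 3))) := by
  have hs : 0 < σ + 1 := by linarith
  have hNpos : 0 < (N : ℝ) := Nat.cast_pos.mpr (lt_of_lt_of_le Nat.one_pos hN1)
  have hPN : 0 < ∑ n ∈ range N, ((n : ℝ) + 1) ^ σ :=
    lt_of_lt_of_le (Real.rpow_pos_of_pos hNpos _) (powerMass_lower hσ0 hN1)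
  exact wsqrt_law (p := fun n : ℕ => ((n : ℝ) + 1) ^ σ) (fun n => Real.rpow_nonneg (by positivity) σ) hK
    (div_pos hs (by linarith)) hN1 hE0 hE1 hPN
    (fun J h1 h2 => powerMass_localGrowth hσ1 hσ0 hN1 h1 h2) (powerMass_tripling hσ1 hσ0 hN1) hlip hmean

end

end Summit.QuantumFields.BalabanUV.Beta.EriceFlowEnclosureWeightedTauberianSeqRate
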